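import Mathlib
import Summits.ResolutionOfSingularities.ResolutionOfSingularities.Theorems.RadicialJungCleanModelsCleanProp44NearLineFinal
import Summits.ResolutionOfSingularities.ResolutionOfSingularities.Theorems.RadicialJungCleanModelsCleanProp44NearLineBirthScheme
import HarnessLib

/-!
# Route `RadicialJung`, crux `CleanModels` (stmt-ResolutionOfSingularities-15917), line `Sketch` rev 35, stub 6 `stub_cleanProp44` (X44c):
# CLEAN-PERMISSIBILITY OF NEAR LINES, XIII — the EXPLICIT obstruction set on a near line: corners and cross lines

Seat decomp-res-hand-2 g18 (structural hand).  Combination of ✓ `cleanPermissibleAt_nearLine_or_corner_or_birth` (`…NearLineFinal.lean`) and the birth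
test ✓ `cleanPermissibleAt_nearLine_of_cross` (`…NearLineBirthScheme.lean`): the birth disjunct (an `∃ U …` over unit presentations) is replaced by
the EXPLICIT condition «`p ∣ Σ a_k`, no clean side through `x'`, and `x'` lies on the strict transform of some cross hypersurface
`V(a_{k₁} m_{k₂} c_{k₂} - a_{k₂} m_{k₁} c_{k₁})`» — on `E_x` these are lines through the vertices of the clean triangle (memo 4e §2.4 (B2)).

* `cleanPermissibleAt_nearLine_or_corner_or_cross` — at every point `x'` (with `dim 𝒪_{X',x'} = 3`) of the near line of `y = t_{j₀} = Σ_k m_k c_k`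
  after the blowing up of a clean point `x` (`(c, u, a)` the clean data, `n ≥ 3`, every `a_k` zero or prime to `p`): the line of `τ♯G` is
  CLEAN-PERMISSIBLE at `x'` for `N = (e', y')`, OR `x'` is a corner of the clean divisor met by `N` in a non-axis direction, OR (`p ∣ Σ a`, no
  clean side through `x'`, and `(τ♯ w_{k₁k₂}) ≠ 𝔪_x𝒪_{x'}` for some `k₁ ≠ k₂`).

So the candidate insertion points on a near line are read off the clean data at `x` and the coefficients `m` of `y` ALONE.  Honest framing: OURS;
a TOOL for the (R1ᵐⁱⁿ)/(R3ᵐⁱⁿ′) provers; the global count and the termination measure are NOT addressed.  Nothing here proves X44c, any case of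
`CleanModels`, or resolution of singularities in characteristic `p`.  Setting only: [cite: CossartPiltant2008, Lemma 4.3 (5); Prop. 4.4]
[cite: Piltant2013, §2 Axiom 4].
-/

noncomputable section

set_option linter.dupNamespace false -- mandated namespace of this single-conjunct summit

open IsLocalRing CategoryTheory AlgebraicGeometry
open Literature.AlgebraicGeometry.Resolution Literature.AlgebraicGeometry.Motives

namespace Summit.ResolutionOfSingularities.ResolutionOfSingularities.Theorems.RadicialJung.CleanModels

universe u

section Scheme

variable {p : ℕ} {X X' : Scheme.{u}} [IsIntegral X] [IsIntegral X'] {τ : X' ⟶ X} [IsDominant τ] {J : X.IdealSheafData}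

set_option maxHeartbeats 800000 in
-- long statement, short proof
/-- **The explicit obstruction set on a near line: corners and cross lines.**  See the module docstring.
[cite: CossartPiltant2008, Lemma 4.3 (5); Prop. 4.4 (proof, p. 11)] [cite: Piltant2013, §2 Axiom 4] -/
theorem cleanPermissibleAt_nearLine_or_corner_or_cross [Fact p.Prime] [CharP X.functionField p] (hτ : IsBlowup τ J) (x' : X')
    (hR : IsRegularLocalRing (X.presheaf.stalk (τ x'))) {n : ℕ} (hn : 3 ≤ n) (c : Fin n → X.presheaf.stalk (τ x'))
    (hc : Ideal.span (Set.range c) = maximalIdeal (X.presheaf.stalk (τ x')))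
    (hdim : ringKrullDim (X.presheaf.stalk (τ x')) = (n : WithBot ℕ∞)) (hJ : stalkIdeal J (τ x') = maximalIdeal (X.presheaf.stalk (τ x')))
    {G : X.functionField} {cc : Fin p → X.functionField} (hcc : ∃ j : Fin p, (j : ℕ) ≠ 0 ∧ cc j ≠ 0)
    {u : X.presheaf.stalk (τ x')} (hu : IsUnit u) {a : Fin n → ℕ}
    (hrep : (∑ j : Fin p, cc j ^ p * G ^ (j : ℕ)) = RatFn.toFunctionField (τ x') (u * ∏ k, c k ^ a k))
    (hall : ∀ k, a k = 0 ∨ ¬ p ∣ a k) (hdim' : ringKrullDim (X'.presheaf.stalk x') = 3)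
    {d : ℕ} (t : Fin d → X.presheaf.stalk (τ x')) (hspan : Ideal.span (Set.range t) = maximalIdeal (X.presheaf.stalk (τ x')))
    (hdimd : ringKrullDim (X.presheaf.stalk (τ x')) = (d : WithBot ℕ∞)) (j₀ : Fin d) (m : Fin n → X.presheaf.stalk (τ x'))
    (hy : t j₀ = ∑ k, m k * c k) {e' y' z' : X'.presheaf.stalk x'}
    (he' : Ideal.span {e'} = (maximalIdeal (X.presheaf.stalk (τ x'))).map (τ.stalkMap x').hom)
    (hy' : (τ.stalkMap x').hom (t j₀) = e' * y') (hy'm : y' ∈ maximalIdeal (X'.presheaf.stalk x'))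
    (hzz : Ideal.span ({e', y', z'} : Set (X'.presheaf.stalk x')) = maximalIdeal (X'.presheaf.stalk x')) :
    CleanPermissibleAt p (RatFn.toFunctionField x') (RatFn.functionFieldMap τ G) (Ideal.span ({e', y'} : Set (X'.presheaf.stalk x'))) ∨
    (∃ (k₁ k₂ : Fin n) (s₁ s₂ : X'.presheaf.stalk x'), k₁ ≠ k₂ ∧ a k₁ ≠ 0 ∧ a k₂ ≠ 0 ∧
        (τ.stalkMap x').hom (c k₁) = e' * s₁ ∧ (τ.stalkMap x').hom (c k₂) = e' * s₂ ∧
        Ideal.span ({e', s₁, s₂} : Set (X'.presheaf.stalk x')) = maximalIdeal (X'.presheaf.stalk x') ∧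
        s₁ ∉ Ideal.span ({e', y'} : Set (X'.presheaf.stalk x')) ∧ s₂ ∉ Ideal.span ({e', y'} : Set (X'.presheaf.stalk x'))) ∨
    (p ∣ ∑ k, a k ∧ (∀ k, a k ≠ 0 → Ideal.span {(τ.stalkMap x').hom (c k)} = (maximalIdeal (X.presheaf.stalk (τ x'))).map (τ.stalkMap x').hom) ∧
      ∃ k₁ k₂ : Fin n, k₁ ≠ k₂ ∧
        Ideal.span {(τ.stalkMap x').hom ((a k₁ : X.presheaf.stalk (τ x')) * (m k₂ * c k₂) - (a k₂ : X.presheaf.stalk (τ x')) * (m k₁ * c k₁))} ≠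
          (maximalIdeal (X.presheaf.stalk (τ x'))).map (τ.stalkMap x').hom) := by
  classical
  haveI : CharP X'.functionField p := charP_of_injective_ringHom (RatFn.functionFieldMap τ).injective p
  -- the form-(1) currency with `w = ∅`
  have hz : Ideal.span (Set.range (Fin.append c Fin.elim0)) = maximalIdeal (X.presheaf.stalk (τ x')) := by
    rw [Fin.append_elim0]
    have hsurj : Function.Surjective (Fin.cast (Nat.add_zero n)) := fun i => ⟨Fin.cast (Nat.add_zero n).symm i, Fin.ext rfl⟩
    rw [hsurj.range_comp, hc]
  have hdim0 : ringKrullDim (X.presheaf.stalk (τ x')) = ((n + 0 : ℕ) : WithBot ℕ∞) := by rw [Nat.add_zero]; exact hdim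
  have hcJ : Ideal.span (Set.range c) = stalkIdeal J (τ x') := hc.trans hJ.symm
  have hrep' : (∑ j : Fin p, cc j ^ p * G ^ (j : ℕ)) =
      RatFn.toFunctionField (τ x') (u * (∏ k, c k ^ a k) * ∏ m' : Fin 0, (Fin.elim0 m' : X.presheaf.stalk (τ x')) ^ (Fin.elim0 m' : ℕ)) := by
    rw [hrep, Fin.prod_univ_zero, mul_one]
  have he'J : Ideal.span {e'} = (stalkIdeal J (τ x')).map (τ.stalkMap x').hom := by rw [hJ]; exact he'
  rcases cleanPermissibleAt_nearLine_or_corner_or_birth hτ x' hR c Fin.elim0 hz hdim0 hcJ hJ hcc hu hrep' (fun m' => m'.elim0) hall hdim'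
      t hspan hdimd j₀ he'J hy' hy'm hzz with h | h | ⟨hA, hsides, -⟩
  · exact Or.inl h
  · exact Or.inr (Or.inl h)
  · have hsides' : ∀ k, a k ≠ 0 → Ideal.span {(τ.stalkMap x').hom (c k)} = (maximalIdeal (X.presheaf.stalk (τ x'))).map (τ.stalkMap x').hom := by
      intro k hk; rw [hsides k hk, hJ]
    by_cases hW : ∀ k₁ k₂ : Fin n, k₁ ≠ k₂ →
        Ideal.span {(τ.stalkMap x').hom ((a k₁ : X.presheaf.stalk (τ x')) * (m k₂ * c k₂) - (a k₂ : X.presheaf.stalk (τ x')) * (m k₁ * c k₁))} =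
          (maximalIdeal (X.presheaf.stalk (τ x'))).map (τ.stalkMap x').hom
    · left
      have hy'' : (τ.stalkMap x').hom (∑ k, m k * c k) = e' * y' := by rw [← hy]; exact hy'
      exact cleanPermissibleAt_nearLine_of_cross hτ x' hR hn c hc hdim hJ hcc hu hrep hsides' hdim' m he' hy'' hy'm hzz hW
    · right; right
      push Not at hW
      obtain ⟨k₁, k₂, hk, hne⟩ := hW
      exact ⟨hA, hsides', k₁, k₂, hk, hne⟩

end Scheme

end Summit.ResolutionOfSingularities.ResolutionOfSingularities.Theorems.RadicialJung.CleanModels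

end
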